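import Summits.NavierStokesRegularity.FluidComputer.PalasekTowerGermHostIsometry
import Summits.NavierStokesRegularity.FluidComputer.PalasekTowerMechanismDoorAtScaled

/-!
# The germ host under AFFINE DILATIONS: the strict slot `LevelZeroDataAt R` filled by a RESCALED kit slice
# (Newtonian potential and NS acceleration under `y ↦ x₀ + g y`, amplitude `κ`, viscosity `ν' = g/κ`)

Cell `ns-blowup`, seat `ns-blowup-ecbridge-3` (g12; D-0074 GROUP C «BRIDGE SUPPORT», lineage `host_preparation`).
Route `PalasekTowerBreakdown` (rev 19); crux stmt-NavierStokesRegularity-20303 `EpisodeBaseT` and the heredity pair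
20304/20305. LABEL: E–C typing (KERNEL: theorems only; no definition, no named fact). WHAT THIS IS NOT: not
Navier–Stokes evidence — change-of-variables identities for PRESCRIBED fields and the transport of the strict-slot
clauses through them; no profile is exhibited and nothing is asserted about any free run.

## The point

The companion-free germ line asks the released slice `U` to fill the STRICT SLOT `Germ.LevelZeroDataAt R U ρ` (support,
ceiling `Y₀(R)` attained, strain `A₀(R)`, an `N₀(R)`-core, and the strict first-order anchor `0 < ⟪U x, accel 1 U x⟫`
at every argmax), in REGISTER units. A kit slice `u` lives in other units; the register profile is
`U(y) = κ • u(x₀ + g • y)` with `g = κ ν'` (`κ` = speed conversion, `ν'` = kit viscosity; cf.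
`PalasekTowerMechanismDoorAtScaled`). This file proves that the NONLOCAL anchor clause transports too: the Newtonian
potential of the divergence scales as `π[c • G(x₀ + g ·)](y) = (c/g) π[G](x₀ + g y)` (`newtonKernel` is homogeneous of
degree `−1`, `integral_comp_space_affine`), hence the Leray projection commutes with affine dilations, the drift at
viscosity `1` of `U` is `κ²g •` the drift at viscosity `ν'` of `u` (this is where `g = κν'` enters), and
**`accel 1 U (y) = (κ² g) • accel ν' u (x₀ + g y)`** (`accel_smul_comp_affine`) — so the anchor test of `U` at `y` is the
anchor test of `u` at `x₀ + g y` with viscosity `ν'` (`inner_accel_smul_comp_affine`). With the pointwise clauses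
(support radius `ρ/g`, strain `× κg`, loops pulled back by `y = g⁻¹(x − x₀)`, circulation `× κ/g = 1/ν'`)
this gives **`levelZeroDataAt_smul_comp_affine`**: the strict slot at `R` in kit units. §3 adds that a slice which is
axisymmetric swirl-free about the kit `x₂`-axis stays so after an ON-AXIS shift and a dilation — the input of the
sterile germ door (`Theorems/PalasekTowerBreakdownEpisodeBaseTSterileGermRun`).

References: A. J. Majda, A. L. Bertozzi (CUP 2002), §1.8 Prop. 1.16 [cite: MajdaBertozziCUP2002, §1.8 Prop. 1.16]; D. Gilbarg,
N. S. Trudinger (2001), §2.4 [cite: GilbargTrudinger2001, Lemma 4.1]; J. Leray, Acta Math. 63 (1934) §20 [cite: Leray1934, §20].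
-/

noncomputable section

namespace Summit.NavierStokesRegularity.FluidComputer.PalasekTowerClayBridge.Germ

open Set Function MeasureTheory InnerProductSpace Metric
open scoped ContDiff RealInnerProductSpace Laplacian
open Literature.Analysis Literature.Analysis.FluidPDE

/-! ## §1 The Newtonian potential, the Leray projection, the drift and the acceleration under an affine dilation -/

section Affine

variable {c g : ℝ} (x₀ : EuclideanSpace ℝ (Fin 3)) {G : EuclideanSpace ℝ (Fin 3) → EuclideanSpace ℝ (Fin 3)}

/-- The pulled-back field `z ↦ c • G(x₀ + g z)` as a rescaled `stPull` slice (definitional). [folklore] -/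
theorem smul_comp_affine_eq_stPull (c g : ℝ) (G : EuclideanSpace ℝ (Fin 3) → EuclideanSpace ℝ (Fin 3)) :
    (fun z => c • G (x₀ + g • z)) = (c • stPull 0 g 0 x₀ (fun _ : ℝ => G)) 0 := by
  funext z
  rw [smul_stPull_apply]

/-- `div (c • G(x₀ + g ·))(z) = c g · (div G)(x₀ + g z)` for a differentiable `G`. [folklore] -/
theorem divergence_smul_comp_affine (hG : Differentiable ℝ G) (c g : ℝ) (z : EuclideanSpace ℝ (Fin 3)) :
    VectorCalculus.divergence (fun z => c • G (x₀ + g • z)) z =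
      c * (g * VectorCalculus.divergence G (x₀ + g • z)) := by
  have hd : DifferentiableAt ℝ (stPull 0 g 0 x₀ (fun _ : ℝ => G) 0) z :=
    differentiable_stPull_slice (u := fun _ : ℝ => G) hG z
  have h1 : (fun z => c • G (x₀ + g • z)) = fun z => c • stPull 0 g 0 x₀ (fun _ : ℝ => G) 0 z := by
    funext z; rw [stPull_apply]
  rw [h1, divergence_const_smul_apply hd, divergence_stPull]

/-- **The Newtonian potential of the divergence under an affine dilation**:
`π[c • G(x₀ + g ·)](y) = (c/g) · π[G](x₀ + g y)` (`g > 0`; `Γ` homogeneous of degree `−1`). [cite: GilbargTrudinger2001, Lemma 4.1] -/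
theorem divPotential_smul_comp_affine (hG : Differentiable ℝ G) (c : ℝ) (hg : 0 < g) (y : EuclideanSpace ℝ (Fin 3)) :
    divPotential (fun z => c • G (x₀ + g • z)) y = c / g * divPotential G (x₀ + g • y) := by
  rw [divPotential_apply, divPotential_apply]
  simp_rw [divergence_smul_comp_affine x₀ hG]
  -- substitute `s = x₀ + g • t`
  have hsub := integral_comp_space_affine (E := EuclideanSpace ℝ (Fin 3)) hg x₀
    (fun s => newtonKernel (x₀ + g • y - s) * VectorCalculus.divergence G s)
  have hker : ∀ t : EuclideanSpace ℝ (Fin 3),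
      newtonKernel (x₀ + g • y - (x₀ + g • t)) = g⁻¹ * newtonKernel (y - t) := by
    intro t
    rw [show x₀ + g • y - (x₀ + g • t) = g • (y - t) by rw [smul_sub]; abel, newtonKernel_smul hg]
  simp_rw [hker] at hsub
  have h3 : (fun t : EuclideanSpace ℝ (Fin 3) => newtonKernel (y - t) * (c * (g * VectorCalculus.divergence G (x₀ + g • t))))
      = fun t => (c * g ^ 2) * (g⁻¹ * newtonKernel (y - t) * VectorCalculus.divergence G (x₀ + g • t)) := by
    funext t
    rw [show c * g ^ 2 * (g⁻¹ * newtonKernel (y - t) * VectorCalculus.divergence G (x₀ + g • t)) =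
        (g * g⁻¹) * (newtonKernel (y - t) * (c * (g * VectorCalculus.divergence G (x₀ + g • t)))) by ring,
      mul_inv_cancel₀ hg.ne', one_mul]
  rw [h3, integral_const_mul, hsub, finrank_euclideanSpace, Fintype.card_fin, smul_eq_mul, ← mul_assoc]
  congr 1
  rw [div_eq_mul_inv, show c * g ^ 2 * (g ^ 3)⁻¹ = c * (g ^ 2 * (g ^ 3)⁻¹) by ring,
    show g ^ 2 * (g ^ 3)⁻¹ = g⁻¹ from by
      rw [show g ^ 3 = g ^ 2 * g by ring, mul_inv, ← mul_assoc, mul_inv_cancel₀ (pow_ne_zero 2 hg.ne'), one_mul]]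

/-- Function form: `π[c • G(x₀ + g ·)] = (c/g) • (π[G] ∘ (x₀ + g ·))`, i.e. an `stPull` of `π[G]`. [folklore] -/
theorem divPotential_smul_comp_affine_eq (hG : Differentiable ℝ G) (c : ℝ) (hg : 0 < g) :
    divPotential (fun z => c • G (x₀ + g • z)) = fun y => (c / g) • stPull 0 g 0 x₀ (fun _ : ℝ => divPotential G) 0 y := by
  funext y
  rw [divPotential_smul_comp_affine x₀ hG c hg, stPull_apply, smul_eq_mul]

/-- **The gradient of the potential scales back by `g`**: `∇π[c • G(x₀ + g ·)](y) = c • ∇π[G](x₀ + g y)` for a smooth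
compactly supported `G`. [cite: MajdaBertozziCUP2002, §1.8 Prop. 1.16] -/
theorem gradient_divPotential_smul_comp_affine (hG : ContDiff ℝ ∞ G) (hGc : HasCompactSupport G) (c : ℝ) (hg : 0 < g)
    (y : EuclideanSpace ℝ (Fin 3)) :
    gradient (divPotential (fun z => c • G (x₀ + g • z))) y = c • gradient (divPotential G) (x₀ + g • y) := by
  have hπ : Differentiable ℝ (divPotential G) := (contDiff_divPotential hG hGc).differentiable (by simp)
  have hd : DifferentiableAt ℝ (stPull 0 g 0 x₀ (fun _ : ℝ => divPotential G) 0) y :=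
    differentiable_stPull_slice (u := fun _ : ℝ => divPotential G) hπ y
  rw [divPotential_smul_comp_affine_eq x₀ (hG.differentiable (by simp)) c hg, gradient_const_smul hd, gradient_stPull,
    smul_smul, div_mul_cancel₀ _ hg.ne']

/-- **The Leray projection commutes with affine dilations**: `P[c • G(x₀ + g ·)](y) = c • P[G](x₀ + g y)`.
[cite: MajdaBertozziCUP2002, §1.8 Prop. 1.16] -/
theorem classicalLerayProj_smul_comp_affine (hG : ContDiff ℝ ∞ G) (hGc : HasCompactSupport G) (c : ℝ) (hg : 0 < g)
    (y : EuclideanSpace ℝ (Fin 3)) :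
    classicalLerayProj (fun z => c • G (x₀ + g • z)) y = c • classicalLerayProj G (x₀ + g • y) := by
  rw [classicalLerayProj_apply, classicalLerayProj_apply, gradient_divPotential_smul_comp_affine x₀ hG hGc c hg, smul_sub]

variable {u : EuclideanSpace ℝ (Fin 3) → EuclideanSpace ℝ (Fin 3)} {ν' κ : ℝ}

/-- **The drift under the kit-to-register map**: for `U(y) = κ • u(x₀ + g y)` with `g = κ ν'`,
`drift 1 U (y) = (κ² g) • drift ν' u (x₀ + g y)` (`Δ` scales by `κ g²`, `(U·∇)U` by `κ² g`). [cite: Leray1934, §20] -/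
theorem drift_smul_comp_affine (hu : ContDiff ℝ 2 u) (y : EuclideanSpace ℝ (Fin 3)) :
    drift 1 (fun z => κ • u (x₀ + (κ * ν') • z)) y = (κ ^ 2 * (κ * ν')) • drift ν' u (x₀ + (κ * ν') • y) := by
  set g : ℝ := κ * ν' with hg
  have hd : Differentiable ℝ u := hu.differentiable (by norm_cast)
  have hds : DifferentiableAt ℝ (stPull 0 g 0 x₀ (fun _ : ℝ => u) 0) y := differentiable_stPull_slice (u := fun _ : ℝ => u) hd y
  have h2s : ContDiffAt ℝ 2 (stPull 0 g 0 x₀ (fun _ : ℝ => u) 0) y := (contDiff_stPull_slice (u := fun _ : ℝ => u) hu).contDiffAt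
  set S : EuclideanSpace ℝ (Fin 3) → EuclideanSpace ℝ (Fin 3) := stPull 0 g 0 x₀ (fun _ : ℝ => u) 0 with hS
  have hU : (fun z => κ • u (x₀ + g • z)) = κ • S := by
    rw [smul_comp_affine_eq_stPull x₀ κ g u]; rfl
  have hSy : S y = u (x₀ + g • y) := by rw [hS, stPull_apply]
  -- the Laplacian: `Δ(κ • S) y = κ • g² • Δu (x₀ + g y)`
  have hlap : (Δ (κ • S)) y = (κ * g ^ 2) • (Δ u) (x₀ + g • y) := by
    rw [InnerProductSpace.laplacian_smul κ h2s, hS, laplacian_stPull 0 g 0 x₀ (fun _ : ℝ => u) 0 y hu, smul_smul]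
  -- the convective term: `((κS)·∇)(κS) y = κ² g • (u·∇u)(x₀ + g y)`
  have hconv : convect (κ • S) (κ • S) y = (κ ^ 2 * g) • convect u u (x₀ + g • y) := by
    rw [convect_apply, fderiv_const_smul hds, FunLike.coe_smul, Pi.smul_apply, ← convect_apply, hS, convect_stPull,
      convect_apply, Pi.smul_apply, ← hS, hSy, map_smul, smul_smul, smul_smul]
    beta_reduce
    congr 1
    ring
  unfold drift
  rw [hU, hlap, hconv, one_smul, smul_sub, smul_smul]
  congr 1
  rw [hg, show κ * (κ * ν') ^ 2 = κ ^ 2 * (κ * ν') * ν' by ring]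

/-- **THE NS ACCELERATION UNDER THE KIT-TO-REGISTER MAP**: `accel 1 U (y) = (κ² g) • accel ν' u (x₀ + g y)` for
`U(y) = κ • u(x₀ + g y)`, `g = κν'`, `u` smooth with compact support. [cite: MajdaBertozziCUP2002, §1.8 Prop. 1.16] -/
theorem accel_smul_comp_affine (hu : ContDiff ℝ ∞ u) (huc : HasCompactSupport u) (hν' : 0 < ν') (hκ : 0 < κ)
    (y : EuclideanSpace ℝ (Fin 3)) :
    accel 1 (fun z => κ • u (x₀ + (κ * ν') • z)) y = (κ ^ 2 * (κ * ν')) • accel ν' u (x₀ + (κ * ν') • y) := by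
  have hg : 0 < κ * ν' := mul_pos hκ hν'
  have hdrift : drift 1 (fun z => κ • u (x₀ + (κ * ν') • z)) =
      fun y => (κ ^ 2 * (κ * ν')) • drift ν' u (x₀ + (κ * ν') • y) :=
    funext (drift_smul_comp_affine x₀ (hu.of_le (by norm_cast)))
  unfold accel
  rw [hdrift, classicalLerayProj_smul_comp_affine x₀ (contDiff_drift hu ν') (hasCompactSupport_drift huc ν') _ hg]

/-- **The anchor quantity transports**: `⟪U y, accel 1 U y⟫ = κ³ g · ⟪u x, accel ν' u x⟫` at `x = x₀ + g y`. [folklore] -/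
theorem inner_accel_smul_comp_affine (hu : ContDiff ℝ ∞ u) (huc : HasCompactSupport u) (hν' : 0 < ν') (hκ : 0 < κ)
    (y : EuclideanSpace ℝ (Fin 3)) :
    ⟪(fun z => κ • u (x₀ + (κ * ν') • z)) y, accel 1 (fun z => κ • u (x₀ + (κ * ν') • z)) y⟫ =
      (κ * (κ ^ 2 * (κ * ν'))) * ⟪u (x₀ + (κ * ν') • y), accel ν' u (x₀ + (κ * ν') • y)⟫ := by
  rw [accel_smul_comp_affine x₀ hu huc hν' hκ]
  dsimp only
  rw [real_inner_smul_left, real_inner_smul_right]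
  ring

end Affine

/-! ## §2 The strict slot at `R` filled by a rescaled kit slice -/

section Slot

variable {R : TowerRates} {u : EuclideanSpace ℝ (Fin 3) → EuclideanSpace ℝ (Fin 3)} {ν' κ ρ : ℝ}
  (x₀ : EuclideanSpace ℝ (Fin 3))

/-- The pulled-back point `y = g⁻¹(x − x₀)` of a kit point `x ∈ B̄(x₀, ρ)`: `‖y‖ ≤ ρ/g` and `x₀ + g y = x`. [folklore] -/
theorem pullback_pt {g : ℝ} (hg : 0 < g) {x : EuclideanSpace ℝ (Fin 3)} (hx : ‖x - x₀‖ ≤ ρ) :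
    ‖g⁻¹ • (x - x₀)‖ ≤ ρ / g ∧ x₀ + g • (g⁻¹ • (x - x₀)) = x := by
  refine ⟨?_, ?_⟩
  · rw [norm_smul, Real.norm_of_nonneg (inv_nonneg.2 hg.le), inv_mul_eq_div]
    exact div_le_div_of_nonneg_right hx hg.le
  · rw [smul_smul, mul_inv_cancel₀ hg.ne', one_smul, add_sub_cancel]

/-- **THE STRICT SLOT AT `R` IN KIT UNITS.** Let `u` be a smooth divergence-free kit slice supported in `B̄(x₀, ρ)`,
`κ, ν' > 0`, `g = κν'`, with: ceiling `κ‖u‖ ≤ Y₀(R)` everywhere and `Y₀(R) ≤ κ‖u x‖` at some `x ∈ B̄(x₀, ρ)`;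
strain `A₀(R) ≤ κ g ‖Du x‖` at some point of the ball; a `C¹` closed loop inside a ball of radius `g/N₀(R)` centred in the
ball, of speed `≤ 8π g/N₀(R)`, with `ν' N₀(R)^{β−2} ≤ ∮u`; and the kit anchor test `0 < ⟪u x, accel ν' u x⟫` wherever
`κ‖u x‖ = Y₀(R)`. Then `U(y) = κ • u(x₀ + g y)` fills `LevelZeroDataAt R U (ρ/g)`. [cite: Palasek2026ElementaryModel, §3.3] -/
theorem levelZeroDataAt_smul_comp_affine (hν' : 0 < ν') (hκ : 0 < κ) (hu : ContDiff ℝ ∞ u)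
    (hdiv : VectorCalculus.IsDivFree u) (hsupp : tsupport u ⊆ closedBall x₀ ρ)
    (hceil : ∀ x, κ * ‖u x‖ ≤ R.Y 0) (hfloor : ∃ x, ‖x - x₀‖ ≤ ρ ∧ R.Y 0 ≤ κ * ‖u x‖)
    (hstrain : ∃ x, ‖x - x₀‖ ≤ ρ ∧ R.A 0 ≤ κ * (κ * ν') * ‖fderiv ℝ u x‖)
    (hcore : ∃ (x : EuclideanSpace ℝ (Fin 3)) (c : ℝ → EuclideanSpace ℝ (Fin 3)),
      ‖x - x₀‖ ≤ ρ ∧ ContDiff ℝ 1 c ∧ c 0 = c 1 ∧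
      (∀ s ∈ Icc (0 : ℝ) 1, c s ∈ closedBall x (κ * ν' / R.N 0)) ∧
      (∀ s ∈ Icc (0 : ℝ) 1, ‖deriv c s‖ ≤ 8 * Real.pi * (κ * ν') / R.N 0) ∧
      ν' * R.N 0 ^ (R.β - 2) ≤ circulation u c)
    (hanchor : ∀ x, κ * ‖u x‖ = R.Y 0 → 0 < ⟪u x, accel ν' u x⟫) :
    LevelZeroDataAt R (fun y => κ • u (x₀ + (κ * ν') • y)) (ρ / (κ * ν')) := by
  set g : ℝ := κ * ν' with hg
  have hgpos : 0 < g := mul_pos hκ hν'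
  have hg0 : g ≠ 0 := hgpos.ne'
  have hN0 : 0 < R.N 0 := R.N_pos 0
  have huc : HasCompactSupport u :=
    (isCompact_closedBall x₀ ρ).of_isClosed_subset (isClosed_tsupport u) hsupp
  have hd : Differentiable ℝ u := hu.differentiable (by simp)
  refine ⟨?_, ?_, ?_, ?_, ?_, ?_, ?_, ?_⟩
  · -- smooth
    rw [smul_comp_affine_eq_stPull x₀ κ g u]
    exact (contDiff_stPull_slice (u := fun _ : ℝ => u) hu).const_smul κ
  · -- support
    refine closure_minimal (fun y hy => ?_) isClosed_closedBall
    have hy' : u (x₀ + g • y) ≠ 0 := by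
      intro h0
      exact hy (by simp [h0])
    have hmem : x₀ + g • y ∈ closedBall x₀ ρ := hsupp (subset_tsupport _ hy')
    rw [mem_closedBall, dist_eq_norm, add_sub_cancel_left, norm_smul, Real.norm_of_nonneg hgpos.le] at hmem
    rw [mem_closedBall, dist_zero_right, le_div_iff₀ hgpos, mul_comm]
    exact hmem
  · -- divergence free
    intro y
    rw [divergence_smul_comp_affine x₀ hd κ g y, hdiv, mul_zero, mul_zero]
  · -- ceiling
    intro y
    show ‖κ • u (x₀ + g • y)‖ ≤ R.Y 0
    rw [norm_smul, Real.norm_of_nonneg hκ.le]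
    exact hceil _
  · -- floor
    obtain ⟨x, hx, hfl⟩ := hfloor
    refine ⟨g⁻¹ • (x - x₀), (pullback_pt x₀ hgpos hx).1, ?_⟩
    show R.Y 0 ≤ ‖κ • u (x₀ + g • (g⁻¹ • (x - x₀)))‖
    rw [(pullback_pt x₀ hgpos hx).2, norm_smul, Real.norm_of_nonneg hκ.le]
    exact hfl
  · -- strain
    obtain ⟨x, hx, hst⟩ := hstrain
    refine ⟨g⁻¹ • (x - x₀), (pullback_pt x₀ hgpos hx).1, ?_⟩
    have hds : DifferentiableAt ℝ (stPull 0 g 0 x₀ (fun _ : ℝ => u) 0) (g⁻¹ • (x - x₀)) :=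
      differentiable_stPull_slice (u := fun _ : ℝ => u) hd _
    rw [smul_comp_affine_eq_stPull x₀ κ g u,
      show (κ • stPull 0 g 0 x₀ (fun _ : ℝ => u)) 0 = κ • stPull 0 g 0 x₀ (fun _ : ℝ => u) 0 from rfl,
      fderiv_const_smul hds, fderiv_stPull, (pullback_pt x₀ hgpos hx).2, norm_smul, norm_smul,
      Real.norm_of_nonneg hκ.le, Real.norm_of_nonneg hgpos.le, ← mul_assoc]
    exact hst
  · -- core loop, pulled back by `y = g⁻¹ (x − x₀)`
    obtain ⟨x, c, hx, hc1, hc01, hball, hspd, hcirc⟩ := hcore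
    refine ⟨g⁻¹ • (x - x₀), fun s => g⁻¹ • (c s - x₀), (pullback_pt x₀ hgpos hx).1, ?_, ?_, ?_, ?_, ?_⟩
    · exact (hc1.sub contDiff_const).const_smul _
    · simp only [hc01]
    · intro s hs
      have h := hball s hs
      rw [mem_closedBall, dist_eq_norm] at h ⊢
      rw [← smul_sub, sub_sub_sub_cancel_right, norm_smul, Real.norm_of_nonneg (inv_nonneg.2 hgpos.le)]
      calc g⁻¹ * ‖c s - x‖ ≤ g⁻¹ * (κ * ν' / R.N 0) := mul_le_mul_of_nonneg_left h (inv_nonneg.2 hgpos.le)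
        _ = 1 / R.N 0 := by rw [← hg]; field_simp
    · intro s hs
      have h := hspd s hs
      rw [deriv_fun_const_smul_field, deriv_sub_const, norm_smul, Real.norm_of_nonneg (inv_nonneg.2 hgpos.le)]
      calc g⁻¹ * ‖deriv c s‖ ≤ g⁻¹ * (8 * Real.pi * (κ * ν') / R.N 0) :=
            mul_le_mul_of_nonneg_left h (inv_nonneg.2 hgpos.le)
        _ = 8 * Real.pi / R.N 0 := by rw [← hg]; field_simp
    · rw [StrainDoor.circulation_smul_affine_pullback hg0 x₀ u c,
        show κ / g = ν'⁻¹ from by rw [hg, ← div_div, div_self hκ.ne', one_div]]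
      rw [inv_mul_eq_div, le_div_iff₀ hν', mul_comm]
      exact hcirc
  · -- the strict anchor test
    intro y hy
    rw [inner_accel_smul_comp_affine x₀ hu huc hν' hκ]
    refine mul_pos (by positivity) (hanchor _ ?_)
    have hy' : ‖κ • u (x₀ + (κ * ν') • y)‖ = R.Y 0 := hy
    rwa [norm_smul, Real.norm_of_nonneg hκ.le] at hy'

end Slot

/-! ## §3 On-axis shifts and dilations keep a slice axisymmetric swirl-free -/

section Sterile

variable {u : EuclideanSpace ℝ (Fin 3) → EuclideanSpace ℝ (Fin 3)} {x₀ : EuclideanSpace ℝ (Fin 3)}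

/-- A point on the `x₂`-axis is fixed by every rotation about it. [folklore] -/
theorem rotZ_of_onAxis (hx0 : x₀ 0 = 0) (hx1 : x₀ 1 = 0) (θ : ℝ) : rotZ θ x₀ = x₀ := by
  ext i
  fin_cases i <;> simp [rotZ, hx0, hx1]

/-- Rotations about the axis are linear: `R_θ (x₀ + g • y) = R_θ x₀ + g • R_θ y`. [folklore] -/
theorem rotZ_add_smul (θ : ℝ) (x₀ y : EuclideanSpace ℝ (Fin 3)) (g : ℝ) :
    rotZ θ (x₀ + g • y) = rotZ θ x₀ + g • rotZ θ y := by
  rw [← rotZLIE_apply, map_add, map_smul, rotZLIE_apply, rotZLIE_apply]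

/-- **An axisymmetric slice, shifted along the axis and dilated, is axisymmetric.** [cite: MajdaBertozziCUP2002, §2.3.3 (2.52)–(2.53)] -/
theorem isAxisymmetric_smul_comp_onAxis_affine (hu : IsAxisymmetric u) (hx0 : x₀ 0 = 0) (hx1 : x₀ 1 = 0) (κ g : ℝ) :
    IsAxisymmetric (fun y => κ • u (x₀ + g • y)) := by
  intro θ y
  show κ • u (x₀ + g • rotZ θ y) = rotZ θ (κ • u (x₀ + g • y))
  rw [show x₀ + g • rotZ θ y = rotZ θ (x₀ + g • y) by rw [rotZ_add_smul, rotZ_of_onAxis hx0 hx1], hu θ,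
    ← rotZLIE_apply θ (κ • u (x₀ + g • y)), map_smul, rotZLIE_apply]

/-- **A swirl-free slice, shifted along the axis and dilated (`g ≠ 0`), is swirl-free.** [cite: MajdaBertozziCUP2002, §2.3.3 (2.52)–(2.53)] -/
theorem hasNoSwirl_smul_comp_onAxis_affine (hsw : HasNoSwirl u) (hx0 : x₀ 0 = 0) (hx1 : x₀ 1 = 0) (κ : ℝ) {g : ℝ}
    (hg : g ≠ 0) : HasNoSwirl (fun y => κ • u (x₀ + g • y)) := by
  intro y
  have e0 : (x₀ + g • y) 0 = g * y 0 := by simp [hx0]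
  have e1 : (x₀ + g • y) 1 = g * y 1 := by simp [hx1]
  have es : ∀ i, (κ • u (x₀ + g • y)) i = κ * u (x₀ + g • y) i := fun i => by simp
  have h := hsw (x₀ + g • y)
  unfold swirl at h ⊢
  rw [e0, e1] at h
  rw [es, es]
  have h' : g * (y 0 * u (x₀ + g • y) 1 - y 1 * u (x₀ + g • y) 0) = 0 := by
    rw [← h]; ring
  rcases mul_eq_zero.1 h' with h0 | h0
  · exact absurd h0 hg
  · linear_combination κ * h0

end Sterile

end Summit.NavierStokesRegularity.FluidComputer.PalasekTowerClayBridge.Germ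

end
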